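/-
Origin: expansion seat `prover-pub-hodgecm-mc-carch-1-g4-0`, handover #CA39 2026-08-20T09:14Z md5 8320f69fe7ce (86 l., 3 decls; NEW additive leaf; imports #CA38 (this kit) + installed RUN-45 #CA35 Model.ArchKTypeOfLineR1Family; RUN 46; INSTALL after #CA38; drops with #CA37/#CA38; cert certs/ax-ArchKTypeOfSigmaR1Family-8320f69fe7ce.log: rc 0 / 10 s / 0 warnings / 3/3 trio) (`HOME/mc/pub-hodgecm-mc-carch-1/pkg46/HodgeCM/Model/ArchKTypeOfSigmaR1Family.lean`, md5 8320f69fe7ce, 86 lines);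
landed by the second packager p2 gen 5 (p2-g5) in gate run 46 as `HodgeCM/Model/ArchKTypeOfSigmaR1Family.lean` (verbatim).
-/
/-
Copyright (c) 2026. Released under Apache 2.0 license as described in the file LICENSE.
Cell pub-hodgecm, MODEL layer (construction prover mc-carch-1, gen 4), BINDER-OWNERS row 12 `C`, junction (C-Σ): (V-val) at the R1 pin
as a GUARDED FAMILY statement in E's binder style.
-/
import Summits.HodgeConjecture.HodgeCM.Model.ArchKTypeOfSigmaIotaVal
import Summits.HodgeConjecture.HodgeCM.Model.ArchKTypeOfLineR1Family

/-!
# (C-Σ) § 5: binder-2's (V-val) `hκ` AT THE R1 PIN, under the OG guard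

#CA38 `hκ_R1` read at the constructed character family `SInstance.χVR` (#CA35) under sinst's guard `SInstance.GOG V c`
(`(mk ι₁).embedding = ι₁ ∧ GoodCtx (orientBitι L ι₁) ι₁ c`): the splitting families are E's `hGR hGR₀ hGR₁`, the plane-definiteness is
`hG_GOG`, the slot positivities are `hpos_GOG`, the type fact is `hasArchType_χVR_of_GOG`, the un-twist guard is `hG.1`.

* `SInstance.hκ_R1_of_GOG (hG : GOG V c) (χW) (k : KInfty V)` — the rows-18/19 hypothesis `hκ` of binder-2's census kit (#51/#61/#70/#71)
  for EVERY `k ∈ K_∞`, at `η = (χVR ∘ det_V)·(χ_W ∘ det_W)`, any `χ_W`;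
* `SInstance.hκ_R1_of_GOG_eta χW V c hG : ∀ hW k, …` — the same in the socket shape of binder-2 #77 `hyp12/34_of_census_of_hκAt`
  (E's η family `EtaChi.η χVR χW`, any proof `hW` of the plane's definiteness at `ι₁`);
* `SInstance.hn_R1_of_GOG (hG) (hb : b ≠ v₁)` — the (S-norm) normalisation `n_V (w b) = −pairVacExponent b` of #72 at `χVR` (#CA36).

0 records, 0 `def … : Prop`, nothing cited as a hypothesis.
-/

set_option autoImplicit false

noncomputable section

open NumberField NumberField.InfinitePlace
open scoped Matrix Classical
open Literature.NumberTheory.Automorphic Literature.NumberTheory.Automorphic.UnitaryGroup Literature.NumberTheory.Weil1964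
open Literature.NumberTheory.GelbartRogawski1991 Literature.NumberTheory.GelbartRogawski1991.UnitaryDualPair
open HodgeCM.Adelic HodgeCM.PerL34 HodgeCM.Model.HypCensus

namespace HodgeCM.Model.SInstance

variable
  (hGR : ∀ {L : CMField} {ι₁ : L →+* ℂ} (V : HermSpace3 L ι₁) (c : SeesawCtx L),
    (cmSplittingDatum (L : Type) finProdFinEquiv (frameD V) (frameD_real V) (frameD_ne V) (dW c.D) (dW_real c.D)
      (dW_ne c.D)).CompatibleSplitting)
  (hGR₀ : ∀ {L : CMField} {ι₁ : L →+* ℂ} (V : HermSpace3 L ι₁) (c : SeesawCtx L),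
    (cmSplittingDatum (L : Type) (ArchSideTerm.e₁) (frameD V) (frameD_real V) (frameD_ne V) (lineVec (L : Type) (dW c.D 0))
      (fun _ => dW_real c.D 0) (fun _ => dW_ne c.D 0)).CompatibleSplitting)
  (hGR₁ : ∀ {L : CMField} {ι₁ : L →+* ℂ} (V : HermSpace3 L ι₁) (c : SeesawCtx L),
    (cmSplittingDatum (L : Type) (ArchSideTerm.e₁) (frameD V) (frameD_real V) (frameD_ne V) (lineVec (L : Type) (dW c.D 1))
      (fun _ => dW_real c.D 1) (fun _ => dW_ne c.D 1)).CompatibleSplitting)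

/-- **(V-val) `hκ` of rows 18/19 HOLDS AT THE R1 PIN, under the OG guard**, for `χV := χVR` and every `χ_W`. -/
theorem hκ_R1_of_GOG {L : CMField} {ι₁ : L →+* ℂ} (V : HermSpace3 L ι₁) (c : SeesawCtx L) (hG : GOG V c)
    (χW : ContinuousMonoidHom
      (Literature.NumberTheory.Automorphic.relNormOneIdeles (↥(maximalRealSubfield L)) (L : Type) ⧸
        Literature.NumberTheory.Automorphic.relNormOneRat (↥(maximalRealSubfield L)) (L : Type)) Circle)
    (k : ↥(KInfty V)) :
    ((cmDetTwistChar (L : Type) (frameD V) (frameD_ne V) (dW c.D) (dW_ne c.D)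
          (charOfUnitaryLineChar (L : Type) (@χVR @hGR @hGR₀ @hGR₁ _ _ V c)) (charOfUnitaryLineChar (L : Type) χW)
          (kPair V c.D ι₁ V.sylvesterFrame (sylvesterFrame_formCongr V) k) : ℂˣ) : ℂ) *
        ((pinLetterChar V c.D (hGR V c) (hG_GOG V c hG) (kVLetters V c.D (lett V c.D k)) : Circle) : ℂ) *
        dVIota V c.D (lett V c.D k (HypCensus.cmPlace (L : Type) ι₁)) =
      ((UnitaryGroup.archKappa (L : Type) V.Hm ι₁ V.sylvesterFrame (sylvesterFrame_formCongr V) k : ℂˣ) : ℂ) :=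
  hκ_R1 V c (hGR V c) (hGR₀ V c) (hGR₁ V c) (hG_GOG V c hG) (hpos_GOG V c hG).1 (hpos_GOG V c hG).2.1 hG.1 _ χW
    (hasArchType_χVR_of_GOG @hGR @hGR₀ @hGR₁ V c hG) rfl k

/-- **the same in the socket shape of binder-2 #77 `hyp12/34_of_census_of_hκAt`** (`∀ hW k`, E's η family `EtaChi.η χVR χW`, `χ_W` a family). -/
theorem hκ_R1_of_GOG_eta
    (χW : ∀ {L : CMField} {ι₁ : L →+* ℂ} (_V : HermSpace3 L ι₁) (_c : SeesawCtx L),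
      ContinuousMonoidHom (Literature.NumberTheory.Automorphic.relNormOneIdeles (↥(maximalRealSubfield (L : Type))) (L : Type) ⧸
        Literature.NumberTheory.Automorphic.relNormOneRat (↥(maximalRealSubfield (L : Type))) (L : Type)) Circle)
    {L : CMField} {ι₁ : L →+* ℂ} (V : HermSpace3 L ι₁) (c : SeesawCtx L) (hG : GOG V c) :
    ∀ (hW : (∀ j, 0 < (ι₁ (dW c.D j)).re) ∨ ∀ j, (ι₁ (dW c.D j)).re < 0) (k : ↥(KInfty V)),
      ((EtaChi.η (@χVR @hGR @hGR₀ @hGR₁) @χW V c (kPair V c.D ι₁ V.sylvesterFrame (sylvesterFrame_formCongr V) k) : ℂˣ) : ℂ) *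
          ((pinLetterChar V c.D (hGR V c) hW (kVLetters V c.D (lett V c.D k)) : Circle) : ℂ) *
          dVIota V c.D (lett V c.D k (HypCensus.cmPlace (L : Type) ι₁)) =
        ((UnitaryGroup.archKappa (L : Type) V.Hm ι₁ V.sylvesterFrame (sylvesterFrame_formCongr V) k : ℂˣ) : ℂ) :=
  fun hW k => hκ_R1 V c (hGR V c) (hGR₀ V c) (hGR₁ V c) hW (hpos_GOG V c hG).1 (hpos_GOG V c hG).2.1 hG.1 _ (χW V c)
    (hasArchType_χVR_of_GOG @hGR @hGR₀ @hGR₁ V c hG) rfl k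

/-- **the (S-norm) normalisation of #72 HOLDS AT THE R1 PIN, under the OG guard**: `nVR (w b) = −pairVacExponent b`, `b ≠ v₁`. -/
theorem hn_R1_of_GOG {L : CMField} {ι₁ : L →+* ℂ} (V : HermSpace3 L ι₁) (c : SeesawCtx L) (hG : GOG V c)
    {b : {v : InfinitePlace ↥(maximalRealSubfield L) // v.IsReal}} (hb : b ≠ HypCensus.cmPlace (L : Type) ι₁) :
    nVR V c (hGR V c) (hGR₀ V c) (hGR₁ V c) (hG_GOG V c hG) (hpos_GOG V c hG).1 (hpos_GOG V c hG).2.1 (cmPlaceOver (L : Type) b).1 =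
      -pairVacExponent V c.D (hGR V c) (hG_GOG V c hG) b :=
  nVR_eq_neg_pairVacExponent V c (hGR V c) (hGR₀ V c) (hGR₁ V c) (hG_GOG V c hG) (hpos_GOG V c hG).1 (hpos_GOG V c hG).2.1 hb

end HodgeCM.Model.SInstance

end
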